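import Mathlib.MeasureTheory.Integral.Bochner.Set
import Mathlib.MeasureTheory.Integral.Bochner.Basic

/-!
# Two weights proportional on a core have close normalised expectations
# (crux idea `logconcave-core-extension` on ⟨stmt-QuantumFields-24006⟩, generic heart of piece P3(a):
# «`μ_A|_K ∝` charted kernel `|_K` since `A_ω = Φ_ω` on `K`»)

For two nonnegative integrable weights `ζ, w` on a measure space with `ζ = c·w` on a measurable set `K` (`c` a
constant — the two normalisations need not agree) and an observable `O` integrable against both, writing
`E_ζ O = ∫Oζ/∫ζ`, `E_w O = ∫Ow/∫w`, `p_ζ = ∫_{Kᶜ}ζ/∫ζ`, `p_w = ∫_{Kᶜ}w/∫w`: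

* `setIntegral_core_eq_of_prop` : `∫_K O ζ = c ∫_K O w`;
* `core_mass_relation` : `(∫ζ)(1 − p_ζ) = c (∫w)(1 − p_w)`;
* `abs_gibbsMean_sub_gibbsMean_le_of_prop_on_core` :
  `|E_ζ O − E_w O| ≤ |E_ζ[O;Kᶜ]| + |E_w[O;Kᶜ]| + |E_w[O;K]|·|p_w − p_ζ|/(1 − p_w)` (when `p_w < 1`) —
  the surrogate measure and the true measure have the same core expectations up to the off-core masses.

HONEST SCOPE.  Free-hands work of the LEAD seat of ⟨stmt-QuantumFields-24006⟩ (FCL lineage) on an ingredient of an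
UN-TRIAGED crux idea card; elementary measure theory.  No stub of LINE-18, no crux, rung or summit is proved; the
Yang–Mills mass gap is NOT proved by any of this.
-/

noncomputable section

namespace Summit.QuantumFields.YangMills.Theorems.SandwichVariancePinching

open MeasureTheory Set

variable {α : Type*} [MeasurableSpace α] {μ : Measure α}

/-- On the core the two weighted integrals are proportional: `∫_K O ζ = c ∫_K O w`. [folklore] -/
theorem setIntegral_core_eq_of_prop {ζ w O : α → ℝ} {K : Set α} (hK : MeasurableSet K) {c : ℝ}
    (hprop : ∀ x ∈ K, ζ x = c * w x) :
    ∫ x in K, O x * ζ x ∂μ = c * ∫ x in K, O x * w x ∂μ := by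
  rw [← integral_const_mul]
  refine setIntegral_congr_fun hK fun x hx => ?_
  simp only [hprop x hx]; ring

/-- **CORE-PROPORTIONAL WEIGHTS HAVE CLOSE NORMALISED EXPECTATIONS.**  For nonnegative integrable weights
`ζ, w` with `ζ = c·w` on a measurable `K`, `∫w > 0`, `∫ζ > 0`, `∫_{Kᶜ} w < ∫ w`, and `O` with `Oζ`, `Ow` integrable:
`|∫Oζ/∫ζ − ∫Ow/∫w| ≤ |∫_{Kᶜ}Oζ|/∫ζ + |∫_{Kᶜ}Ow|/∫w + (|∫_K Ow|/∫w)·|p_w − p_ζ|/(1 − p_w)`,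
`p_ζ = ∫_{Kᶜ}ζ/∫ζ`, `p_w = ∫_{Kᶜ}w/∫w`. [folklore] -/
theorem abs_gibbsMean_sub_gibbsMean_le_of_prop_on_core {ζ w O : α → ℝ} {K : Set α} (hK : MeasurableSet K)
    {c : ℝ} (hprop : ∀ x ∈ K, ζ x = c * w x)
    (hζi : Integrable ζ μ) (hwi : Integrable w μ)
    (hOζ : Integrable (fun x => O x * ζ x) μ) (hOw : Integrable (fun x => O x * w x) μ)
    (hZζ : 0 < ∫ x, ζ x ∂μ) (hZw : 0 < ∫ x, w x ∂μ) (hpw : ∫ x in Kᶜ, w x ∂μ < ∫ x, w x ∂μ) :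
    |(∫ x, O x * ζ x ∂μ) / (∫ x, ζ x ∂μ) - (∫ x, O x * w x ∂μ) / (∫ x, w x ∂μ)| ≤
      |∫ x in Kᶜ, O x * ζ x ∂μ| / (∫ x, ζ x ∂μ) + |∫ x in Kᶜ, O x * w x ∂μ| / (∫ x, w x ∂μ) +
        |∫ x in K, O x * w x ∂μ| / (∫ x, w x ∂μ) *
          (|(∫ x in Kᶜ, w x ∂μ) / (∫ x, w x ∂μ) - (∫ x in Kᶜ, ζ x ∂μ) / (∫ x, ζ x ∂μ)| /
            (1 - (∫ x in Kᶜ, w x ∂μ) / (∫ x, w x ∂μ))) := by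
  -- names
  set Zζ : ℝ := ∫ x, ζ x ∂μ with hZζdef
  set Zw : ℝ := ∫ x, w x ∂μ with hZwdef
  set Pζ : ℝ := ∫ x in Kᶜ, ζ x ∂μ with hPζ
  set Pw : ℝ := ∫ x in Kᶜ, w x ∂μ with hPw
  set IKζ : ℝ := ∫ x in K, O x * ζ x ∂μ with hIKζ
  set IKw : ℝ := ∫ x in K, O x * w x ∂μ with hIKw
  set ICζ : ℝ := ∫ x in Kᶜ, O x * ζ x ∂μ with hICζ
  set ICw : ℝ := ∫ x in Kᶜ, O x * w x ∂μ with hICw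
  -- splittings over `K ∪ Kᶜ`
  have hsζ : (∫ x, O x * ζ x ∂μ) = IKζ + ICζ := (integral_add_compl hK hOζ).symm
  have hsw : (∫ x, O x * w x ∂μ) = IKw + ICw := (integral_add_compl hK hOw).symm
  have hmζ : Zζ = (∫ x in K, ζ x ∂μ) + Pζ := by rw [hZζdef, hPζ]; exact (integral_add_compl hK hζi).symm
  have hmw : Zw = (∫ x in K, w x ∂μ) + Pw := by rw [hZwdef, hPw]; exact (integral_add_compl hK hwi).symm
  -- proportionality on the core
  have hcoreO : IKζ = c * IKw := by rw [hIKζ, hIKw]; exact setIntegral_core_eq_of_prop hK hprop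
  have hcore1 : (∫ x in K, ζ x ∂μ) = c * ∫ x in K, w x ∂μ := by
    have h := setIntegral_core_eq_of_prop (μ := μ) (O := fun _ => (1:ℝ)) hK hprop
    simpa using h
  -- the core term: `IKζ/Zζ − IKw/Zw = (IKw/Zw)·(pw − pζ)/(1 − pw)`
  have hZζne : Zζ ≠ 0 := hZζ.ne'
  have hZwne : Zw ≠ 0 := hZw.ne'
  have h1pw : 0 < 1 - Pw / Zw := by
    rw [sub_pos, div_lt_one hZw]; exact hpw
  have hD : Zw - Pw ≠ 0 := by
    have : 0 < Zw - Pw := by linarith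
    exact this.ne'
  have h1pw' : 1 - Pw / Zw ≠ 0 := h1pw.ne'
  have hmass : Zζ - Pζ = c * (Zw - Pw) := by
    have h3 : Zζ - Pζ = ∫ x in K, ζ x ∂μ := by linarith
    have h4 : Zw - Pw = ∫ x in K, w x ∂μ := by linarith
    rw [h3, h4, hcore1]
  have hc : c = (Zζ - Pζ) / (Zw - Pw) := by
    rw [hmass]; field_simp
  have hcoreterm : IKζ / Zζ - IKw / Zw = (IKw / Zw) * ((Pw / Zw - Pζ / Zζ) / (1 - Pw / Zw)) := by
    rw [hcoreO, hc]
    have e1 : (Pw / Zw - Pζ / Zζ) / (1 - Pw / Zw) = (Pw * Zζ - Pζ * Zw) / (Zζ * (Zw - Pw)) := by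
      field_simp
    rw [e1]
    field_simp
    ring
  -- assemble
  have hsplit : (∫ x, O x * ζ x ∂μ) / Zζ - (∫ x, O x * w x ∂μ) / Zw =
      ICζ / Zζ - ICw / Zw + (IKζ / Zζ - IKw / Zw) := by
    rw [hsζ, hsw]; field_simp; ring
  rw [hsplit, hcoreterm]
  have hA : |ICζ / Zζ| = |ICζ| / Zζ := by rw [abs_div, abs_of_pos hZζ]
  have hB : |ICw / Zw| = |ICw| / Zw := by rw [abs_div, abs_of_pos hZw]
  have hC : |IKw / Zw * ((Pw / Zw - Pζ / Zζ) / (1 - Pw / Zw))| =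
      |IKw| / Zw * (|Pw / Zw - Pζ / Zζ| / (1 - Pw / Zw)) := by
    rw [abs_mul, abs_div, abs_of_pos hZw, abs_div, abs_of_pos h1pw]
  calc |ICζ / Zζ - ICw / Zw + IKw / Zw * ((Pw / Zw - Pζ / Zζ) / (1 - Pw / Zw))|
      ≤ |ICζ / Zζ - ICw / Zw| + |IKw / Zw * ((Pw / Zw - Pζ / Zζ) / (1 - Pw / Zw))| := abs_add_le _ _
    _ ≤ |ICζ / Zζ| + |ICw / Zw| + |IKw / Zw * ((Pw / Zw - Pζ / Zζ) / (1 - Pw / Zw))| := by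
        have := abs_sub (ICζ / Zζ) (ICw / Zw); linarith
    _ = |ICζ| / Zζ + |ICw| / Zw + |IKw| / Zw * (|Pw / Zw - Pζ / Zζ| / (1 - Pw / Zw)) := by
        rw [hA, hB, hC]

end Summit.QuantumFields.YangMills.Theorems.SandwichVariancePinching

end
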